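import Literature.AlgebraicGeometry.HodgeTheory.FermatClaimShiodaSpine
import HarnessLib

/-!
# D33: every Hodge multiset of `ℤ/33` is stably reachable — the degree-33 saturation certificate of line `cancel-by-any-claim-lattice`

Crux `HodgeFermatVarieties` (stmt-HodgeConjecture-1334, route `PadicSemiregularLift`), line
`cancel-by-any-claim-lattice`. The line's Transfer `hodgeConjectureFor_of_saturated` (skeleton,
sorry-free) turns "every non-empty Hodge multiset of level `m` is STABLY REACHABLE from the printed
supply" (`C⁺(m)`) into HC for every smooth projective Fermat variety `Xⁿₘ`, modulo the named facts of
S0 and the research-risk-nil stubs S2↑, S2↓, S3a, S5 (S1, S3b are landed). This file PROVES `C⁺(33)`: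

    stableReach_thirtyThree : ∀ s : Multiset (ZMod 33), IsHodgeMultiset s → StableReach[33, s]

(`k = 2`: reachability at level `66`). `m = 33` is the first degree open in print (da Silva 2021,
`X⁴₃₃`); at level `33` alone the printed calculus provably does NOT reach da Silva's class
(Disproof §7, `exists_levelCalculusClosed_not_daSilva33`), so the level change is essential.

## Proof (a finite certificate, computed exactly by `calc/d33.py` of the lead's folder, checked here by the kernel)

1. RELATIONS. Summing the Hodge condition `2 Σ_x c_x ⟨tx⟩ = 33 · #s` over `±` four to eight units `t`
   (tables `relCert`) gives, for each of the ten PIVOT residues `p ∈ {1,5,6,10,11,17,19,24,26,30}`,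
   the multiplicity `c_p` of `p` in any Hodge multiset `s` as a `±1`-combination of the multiplicities
   `c_a`, `a ∈ F` (the 22 FREE residues); generic lemma `sum_count_mul_eq_zero_of_cert`, numeric tables
   checked by `decide`. Hence the count vector of `s` is `Σ_{a ∈ F} c_a · v_a` for the graph basis
   `v_a = A a − B a` (`count_eq_sum_graph`), i.e. the multiset identity
   `s + Σ_{a∈F} c_a • B a = Σ_{a∈F} c_a • A a` (`graph_identity`).
2. CERTIFICATES. For each `a ∈ F`: `2•(A a) + Σ(N66 a) = 2•(B a) [+ 2•G if a is odd] + Σ(P66 a)` as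
   multisets of `ℤ/66`, with `P66 a`, `N66 a` explicit families of supply elements of level `66`
   (pairs, Hodge 4-multisets, the standard element `σ_{11,2}`) — 32 distinct generators in all,
   sizes ≤ 9 (`cert66_of_mem_F`, `decide`); the four ODD vectors (`a = 2, 13, 20, 31`, odd number of
   multiples of `11`) are certified relative to da Silva's class `G = {7,10,13,19,22,28}`, whose own
   level-66 certificate `2•G + ΣNEG = ΣPOS` (115 generators; the idea card's certificate, re-verified
   by three triagers and the disprover) is `identity_sixtySix`.
3. ASSEMBLY. Raising the graph identity to level `66` and adding the weighted certificates, the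
   `Σ c_a • 2•(B a)` cancel (multisets are cancellative): `2•s + ΣN = ΣP` with
   `N = Σ_a c_a • N66 a + n • NEG`, `P = Σ_a c_a • P66 a + n • POS`, `n = Σ_{a odd} c_a`.

References: [daSilva2021HodgeFermat] G. da Silva Jr., arXiv:2101.04739, Prop. 3.6 / §3 (the class of
`X⁴₃₃`); [Aoki1987] N. Aoki, J. Math. Soc. Japan 39 (1987) Thm 1-4, Thm 2-1 (the supply);
[Shioda1979PJA] T. Shioda, Proc. Japan Acad. 55A (1979) §1 (the semigroup `Mₘ`).
-/

set_option linter.dupNamespace false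

noncomputable section

open Finset
open Literature.AlgebraicGeometry.HodgeTheory Literature.AlgebraicGeometry.HodgeTheory.FermatCharacter

namespace Summit.HodgeConjecture.HodgeConjecture.Theorems.CancelByAnyClaimLattice.D33

/-- `Supply[M]` — the printed supply of level `M` (local notation of the line, verbatim). -/
local notation3 (prettyPrint := false) "Supply[" M "]" =>
  ({s : Multiset (ZMod M) | ∃ a : ZMod M, a ≠ 0 ∧ s = ({a, -a} : Multiset (ZMod M))} ∪
    {s : Multiset (ZMod M) | IsHodgeMultiset s ∧ Multiset.card s = 4} ∪
    {s : Multiset (ZMod M) | IsHodgeMultiset s ∧ IsSemiDecomposable s} ∪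
    {s : Multiset (ZMod M) | ∃ (p : ℕ) (a : ZMod M), p.Prime ∧ p ≠ 2 ∧ p ∣ M ∧
        2 < (M / p) / Nat.gcd (ZMod.val a) (M / p) ∧
        s = Multiset.map (fun j : ℕ => a + (j : ZMod M) * ((M / p : ℕ) : ZMod M)) (Multiset.range p) +
              {-((p : ZMod M) * a)}} : Set (Multiset (ZMod M)))

/-- `Reach[M, s]` — ℤ-reachability from the supply (local notation of the line, verbatim). -/
local notation3 (prettyPrint := false) "Reach[" M ", " s "]" =>
  ∃ P N : Multiset (Multiset (ZMod M)),
    (∀ u ∈ P, u ∈ Supply[M]) ∧ (∀ u ∈ N, u ∈ Supply[M]) ∧ s + Multiset.sum N = Multiset.sum P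

/-- `LevelRaise[k, m, s]` — level raising `s ↦ k • s` (local notation of the line, verbatim). -/
local notation3 (prettyPrint := false) "LevelRaise[" k ", " m ", " s "]" =>
  Multiset.map (fun a : ZMod m => ((k * ZMod.val a : ℕ) : ZMod (k * m))) s

/-- `StableReach[m, s]` (local notation of the line, verbatim). -/
local notation3 (prettyPrint := false) "StableReach[" m ", " s "]" =>
  ∃ k : ℕ, 0 < k ∧ Reach[k * m, LevelRaise[k, m, s]]

/-! ### §1 Linear relations on count vectors of Hodge multisets from unit-combination certificates -/

/-- `mNormSum` of a map through multiplicities, in `ℤ`. [folklore] -/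
theorem int_mNormSum_map (s : Multiset (ZMod 33)) (f : ZMod 33 → ZMod 33) :
    (mNormSum (s.map f) : ℤ) = ∑ x, (Multiset.count x s : ℤ) * ((f x).val : ℤ) := by
  unfold mNormSum
  rw [Multiset.map_map, sum_map_eq_sum_count_mul s (ZMod.val ∘ f)]
  push_cast
  simp only [Function.comp_apply]

/-- Swapping a list sum of weighted finite sums. [folklore] -/
theorem list_sum_mul_sum_swap (L : List (ZMod 33 × ZMod 33 × ℤ)) (c : ZMod 33 → ℤ)
    (g : ZMod 33 × ZMod 33 × ℤ → ZMod 33 → ℤ) :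
    (L.map fun e ↦ e.2.2 * ∑ x, c x * g e x).sum = ∑ x, c x * (L.map fun e ↦ e.2.2 * g e x).sum := by
  induction L with
  | nil => simp
  | cons e L ih =>
    simp only [List.map_cons, List.sum_cons]
    rw [ih, Finset.mul_sum, ← Finset.sum_add_distrib]
    exact Finset.sum_congr rfl fun x _ ↦ by ring

/-- **A unit-combination certificate yields a linear relation.** If `L` is a list of units `t` of
`ℤ/33` (given with inverses) and weights `μ_t` such that `Σ_t μ_t · 2⟨tx⟩ = 33 Σ_t μ_t + 66 · w(x)`
for every `x ≠ 0`, then `Σ_x c_x(s) · w(x) = 0` for every Hodge multiset `s` of `ℤ/33` (sum the Hodge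
conditions `2 Σ_x c_x ⟨tx⟩ = 33 #s` with the weights `μ_t`). [cite: Shioda1979PJA, §1 eq. (2)] -/
theorem sum_count_mul_eq_zero_of_cert (L : List (ZMod 33 × ZMod 33 × ℤ))
    (hL : ∀ e ∈ L, e.1 * e.2.1 = 1) (w : ZMod 33 → ℤ)
    (htab : ∀ x : ZMod 33, x ≠ 0 →
      (L.map fun e ↦ e.2.2 * (2 * (((e.1 * x).val : ℕ) : ℤ))).sum =
        33 * (L.map fun e ↦ e.2.2).sum + 66 * w x)
    {s : Multiset (ZMod 33)} (hs : IsHodgeMultiset s) :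
    ∑ x, (Multiset.count x s : ℤ) * w x = 0 := by
  set c : ZMod 33 → ℤ := fun x ↦ (Multiset.count x s : ℤ) with hc
  have hunit : ∀ e ∈ L, ∑ x, c x * (2 * (((e.1 * x).val : ℕ) : ℤ)) = 33 * (Multiset.card s : ℤ) := by
    intro e he
    have h := hs.2 (Units.mkOfMulEqOne e.1 e.2.1 (hL e he))
    rw [Units.val_mkOfMulEqOne] at h
    have h' : ((2 * mNormSum (s.map fun a ↦ e.1 * a) : ℕ) : ℤ) = ((33 * Multiset.card s : ℕ) : ℤ) := by
      exact_mod_cast h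
    push_cast at h'
    rw [int_mNormSum_map, Finset.mul_sum] at h'
    rw [← h']
    exact Finset.sum_congr rfl fun x _ ↦ by simp only [hc]; ring
  have c0 : c 0 = 0 := by
    simp only [hc, Nat.cast_eq_zero]
    exact Multiset.count_eq_zero.2 fun h0 ↦ hs.1.1 0 h0 rfl
  -- Σ_e μ_e · (unit equation at e)
  have hsum : (L.map fun e ↦ e.2.2 * ∑ x, c x * (2 * (((e.1 * x).val : ℕ) : ℤ))).sum =
      (L.map fun e ↦ e.2.2).sum * (33 * (Multiset.card s : ℤ)) := by
    rw [← List.sum_map_mul_right]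
    exact congrArg List.sum (List.map_congr_left fun e he ↦ by rw [hunit e he])
  rw [list_sum_mul_sum_swap L c (fun e x ↦ 2 * (((e.1 * x).val : ℕ) : ℤ))] at hsum
  have hpt : ∀ x, c x * (L.map fun e ↦ e.2.2 * (2 * (((e.1 * x).val : ℕ) : ℤ))).sum =
      c x * (33 * (L.map fun e ↦ e.2.2).sum) + 66 * (c x * w x) := by
    intro x
    by_cases hx : x = 0
    · subst hx; simp [c0]
    · rw [htab x hx]; ring
  simp only [hpt, Finset.sum_add_distrib, ← Finset.sum_mul, ← Finset.mul_sum] at hsum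
  have hcard : ∑ x, c x = (Multiset.card s : ℤ) := by
    simp only [hc, card_eq_sum_count s]; push_cast; rfl
  rw [hcard] at hsum
  linarith

/-! ### §2 The tables (computed by `calc/d33.py`; every numeric fact about them is checked by `decide`) -/

/-- The 22 FREE residues `F`: the Hodge lattice `L₃₃ ⊂ ℤ³²` (rank 22) is a graph over them. [folklore] -/
def Fset : Finset (ZMod 33) := {2, 3, 4, 7, 8, 9, 12, 13, 14, 15, 16, 18, 20, 21, 22, 23, 25, 27, 28, 29, 31, 32}

/-- The 10 PIVOT residues: their multiplicities are determined by those on `F`. [folklore] -/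
def Pset : Finset (ZMod 33) := {1, 5, 6, 10, 11, 17, 19, 24, 26, 30}

/-- `A a` — positive part of the graph-basis vector `v_a` (`a ∈ F`), as a multiset of `ℤ/33`; `0` off `F`.
(Computed: calc/d33.py; the Hodge lattice `L₃₃` is a graph over the 22 free coordinates `F`.) [folklore] -/
def A (a : ZMod 33) : Multiset (ZMod 33) :=
  if a = 2 then ({2, 5, 11, 24, 26} : Multiset (ZMod 33)) else
  if a = 3 then ({3, 30} : Multiset (ZMod 33)) else
  if a = 4 then ({1, 4, 5, 26, 30} : Multiset (ZMod 33)) else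
  if a = 7 then ({7, 26} : Multiset (ZMod 33)) else
  if a = 8 then ({8, 19, 30} : Multiset (ZMod 33)) else
  if a = 9 then ({9, 24} : Multiset (ZMod 33)) else
  if a = 12 then ({1, 12, 30} : Multiset (ZMod 33)) else
  if a = 13 then ({10, 13, 19} : Multiset (ZMod 33)) else
  if a = 14 then ({14, 19} : Multiset (ZMod 33)) else
  if a = 15 then ({6, 15, 17} : Multiset (ZMod 33)) else
  if a = 16 then ({16, 17} : Multiset (ZMod 33)) else
  if a = 18 then ({5, 18} : Multiset (ZMod 33)) else
  if a = 20 then ({5, 11, 20, 26} : Multiset (ZMod 33)) else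
  if a = 21 then ({10, 21} : Multiset (ZMod 33)) else
  if a = 22 then ({11, 22} : Multiset (ZMod 33)) else
  if a = 23 then ({10, 23} : Multiset (ZMod 33)) else
  if a = 25 then ({24, 25} : Multiset (ZMod 33)) else
  if a = 27 then ({6, 27} : Multiset (ZMod 33)) else
  if a = 28 then ({5, 28} : Multiset (ZMod 33)) else
  if a = 29 then ({6, 10, 17, 29} : Multiset (ZMod 33)) else
  if a = 31 then ({6, 10, 19, 31} : Multiset (ZMod 33)) else
  if a = 32 then ({1, 32} : Multiset (ZMod 33)) else 0

/-- `B a` — negative part of the graph-basis vector `v_a = A a − B a` (`a ∈ F`). [folklore] -/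
def B (a : ZMod 33) : Multiset (ZMod 33) :=
  if a = 2 then ({6, 10, 19} : Multiset (ZMod 33)) else
  if a = 4 then ({6, 10, 17} : Multiset (ZMod 33)) else
  if a = 8 then ({24} : Multiset (ZMod 33)) else
  if a = 12 then ({10} : Multiset (ZMod 33)) else
  if a = 13 then ({5, 11, 26} : Multiset (ZMod 33)) else
  if a = 15 then ({5} : Multiset (ZMod 33)) else
  if a = 18 then ({6, 17} : Multiset (ZMod 33)) else
  if a = 20 then ({10, 19} : Multiset (ZMod 33)) else
  if a = 21 then ({1, 30} : Multiset (ZMod 33)) else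
  if a = 25 then ({19, 30} : Multiset (ZMod 33)) else
  if a = 29 then ({1, 5, 26, 30} : Multiset (ZMod 33)) else
  if a = 31 then ({5, 11, 24, 26} : Multiset (ZMod 33)) else 0

/-- `oddF a` — the four basis vectors in the odd (`C33`-parity) class: they need the level-66 gap certificate. [folklore] -/
def oddF (a : ZMod 33) : Bool := a = 2 ∨ a = 13 ∨ a = 20 ∨ a = 31

/-- `P66 a` — positive supply part of the level-66 reach certificate of `v_a` (`a ∈ F`). [folklore] -/
def P66 (a : ZMod 33) : Multiset (Multiset (ZMod 66)) :=
  if a = 2 then {({2, 24, 46, 60} : Multiset (ZMod 66))} + {({4, 22, 44, 62} : Multiset (ZMod 66))} + {({6, 28, 48, 50} : Multiset (ZMod 66))} + {({8, 30, 42, 52} : Multiset (ZMod 66))} + {({10, 32, 36, 54} : Multiset (ZMod 66))} else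
  if a = 3 then {({6, 60} : Multiset (ZMod 66))} else
  if a = 4 then {({2, 24, 46, 60} : Multiset (ZMod 66))} + {({8, 30, 42, 52} : Multiset (ZMod 66))} + {({10, 32, 36, 54} : Multiset (ZMod 66))} else
  if a = 7 then {({14, 52} : Multiset (ZMod 66))} else
  if a = 8 then {({28, 38} : Multiset (ZMod 66))} + {({6, 16, 50, 60} : Multiset (ZMod 66))} else
  if a = 9 then {({18, 48} : Multiset (ZMod 66))} else
  if a = 12 then {({2, 24, 46, 60} : Multiset (ZMod 66))} else
  if a = 14 then {({28, 38} : Multiset (ZMod 66))} else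
  if a = 15 then {({12, 30, 34, 56} : Multiset (ZMod 66))} else
  if a = 16 then {({32, 34} : Multiset (ZMod 66))} else
  if a = 18 then {({10, 32, 36, 54} : Multiset (ZMod 66))} else
  if a = 20 then {({2, 26, 40, 64} : Multiset (ZMod 66))} + {({4, 22, 44, 62} : Multiset (ZMod 66))} + {({6, 28, 48, 50} : Multiset (ZMod 66))} + {({8, 30, 42, 52} : Multiset (ZMod 66))} + {({10, 32, 36, 54} : Multiset (ZMod 66))} else
  if a = 21 then {({20, 24, 42, 46} : Multiset (ZMod 66))} else
  if a = 22 then {({22, 44} : Multiset (ZMod 66))} else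
  if a = 23 then {({20, 46} : Multiset (ZMod 66))} else
  if a = 25 then {({6, 28, 48, 50} : Multiset (ZMod 66))} else
  if a = 27 then {({12, 54} : Multiset (ZMod 66))} else
  if a = 28 then {({10, 56} : Multiset (ZMod 66))} else
  if a = 29 then {({8, 12, 54, 58} : Multiset (ZMod 66))} + {({20, 24, 42, 46} : Multiset (ZMod 66))} + {({30, 32, 34, 36} : Multiset (ZMod 66))} else
  if a = 31 then {({4, 12, 54, 62} : Multiset (ZMod 66))} else
  if a = 32 then {({2, 64} : Multiset (ZMod 66))} else 0

/-- `N66 a` — negative supply part of the level-66 reach certificate of `v_a` (`a ∈ F`). [folklore] -/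
def N66 (a : ZMod 33) : Multiset (Multiset (ZMod 66)) :=
  if a = 2 then {({6, 12, 54, 60} : Multiset (ZMod 66))} + {({20, 24, 42, 46} : Multiset (ZMod 66))} + {({28, 30, 36, 38} : Multiset (ZMod 66))} + {({2, 8, 14, 20, 26, 32, 38, 44, 44, 50, 56, 62} : Multiset (ZMod 66))} else
  if a = 4 then {({32, 34} : Multiset (ZMod 66))} + {({12, 20, 46, 54} : Multiset (ZMod 66))} + {({24, 30, 36, 42} : Multiset (ZMod 66))} else
  if a = 8 then {({6, 28, 48, 50} : Multiset (ZMod 66))} else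
  if a = 12 then {({20, 46} : Multiset (ZMod 66))} else
  if a = 13 then {({22, 44} : Multiset (ZMod 66))} + {({10, 14, 52, 56} : Multiset (ZMod 66))} else
  if a = 15 then {({10, 56} : Multiset (ZMod 66))} else
  if a = 18 then {({12, 32, 34, 54} : Multiset (ZMod 66))} else
  if a = 20 then {({4, 26, 48, 54} : Multiset (ZMod 66))} + {({6, 20, 42, 64} : Multiset (ZMod 66))} + {({28, 30, 36, 38} : Multiset (ZMod 66))} + {({2, 8, 14, 20, 26, 32, 38, 44, 44, 50, 56, 62} : Multiset (ZMod 66))} else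
  if a = 21 then {({2, 24, 46, 60} : Multiset (ZMod 66))} else
  if a = 25 then {({6, 28, 38, 60} : Multiset (ZMod 66))} else
  if a = 29 then {({2, 24, 46, 60} : Multiset (ZMod 66))} + {({8, 30, 42, 52} : Multiset (ZMod 66))} + {({10, 32, 36, 54} : Multiset (ZMod 66))} else
  if a = 31 then {({22, 44} : Multiset (ZMod 66))} + {({4, 26, 48, 54} : Multiset (ZMod 66))} + {({10, 14, 52, 56} : Multiset (ZMod 66))} else 0

/-- `relCert p` — for a pivot coordinate `p`, the unit-combination certificate of the relation expressing `c_p`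
through the free coordinates: a list of `(t, t⁻¹, μ_t)`. [folklore] -/
def relCert (p : ZMod 33) : List (ZMod 33 × ZMod 33 × ℤ) :=
  if p = 1 then [(5, 20, -1), (7, 19, -1), (8, 29, -1), (13, 28, -1)] else
  if p = 5 then [(1, 1, -1), (2, 17, 1), (4, 25, 1), (8, 29, -1), (14, 26, -1), (16, 31, -1)] else
  if p = 6 then [(2, 17, -1), (5, 20, 1), (14, 26, 1), (16, 31, 1)] else
  if p = 10 then [(4, 25, -1), (8, 29, 1), (13, 28, 1), (16, 31, 1)] else
  if p = 11 then [(1, 1, -1), (2, 17, 1), (5, 20, 1), (10, 10, -1), (13, 28, -1), (16, 31, -1)] else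
  if p = 17 then [(2, 17, -1), (5, 20, 1), (7, 19, 1), (10, 10, -1)] else
  if p = 19 then [(1, 1, 1), (2, 17, -1), (4, 25, -1), (7, 19, -1), (8, 29, 1), (10, 10, 1), (13, 28, 1), (14, 26, 1)] else
  if p = 24 then [(4, 25, 1), (10, 10, -1), (13, 28, -1), (14, 26, -1)] else
  if p = 26 then [(2, 17, 1), (8, 29, -1), (13, 28, -1), (14, 26, -1)] else
  if p = 30 then [(1, 1, 1), (7, 19, -1), (8, 29, -1), (14, 26, 1)] else []

/-- da Silva's class `G` (unit-orbit representative used by the certificate). [cite: daSilva2021HodgeFermat, Prop. 3.6] -/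
def G : Multiset (ZMod 33) := {7, 10, 13, 19, 22, 28}

/-- `vTab a x = v_a(x)`: the `x`-coordinate of the graph-basis vector `v_a = A a − B a`. [folklore] -/
def vTab (a x : ZMod 33) : ℤ := (Multiset.count x (A a) : ℤ) - (Multiset.count x (B a) : ℤ)

/-- The relation attached to a pivot `p`: `w_p(x) = [x = p] − [x ∈ F] · v_x(p)`. [folklore] -/
def relW (p x : ZMod 33) : ℤ := (if x = p then 1 else 0) - (if x ∈ Fset then vTab x p else 0)

/-- Every residue is `0`, free, or a pivot. [folklore] -/
theorem trichotomy : ∀ x : ZMod 33, x = 0 ∨ x ∈ Fset ∨ x ∈ Pset := by decide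

/-- On `F × F` the graph basis is the identity matrix. [folklore] -/
theorem vTab_F : ∀ x ∈ Fset, ∀ a ∈ Fset, vTab a x = if a = x then 1 else 0 := by
  unfold vTab A B Fset; decide

/-- The basis vectors have no `0`-coordinate. [folklore] -/
theorem vTab_zero : ∀ a ∈ Fset, vTab a 0 = 0 := by
  unfold vTab A B Fset; decide

/-- The certificate entries are units with the listed inverses. [folklore] -/
theorem relCert_units : ∀ p ∈ Pset, ∀ e ∈ relCert p, e.1 * e.2.1 = 1 := by
  unfold relCert Pset; decide

/-- **The ten weight tables**: `Σ_t μ_t · 2⟨tx⟩ = 33 Σ_t μ_t + 66 · w_p(x)` for all `x ≠ 0`.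
(330 numeric identities.) [folklore] -/
theorem relCert_table : ∀ p ∈ Pset, ∀ x : ZMod 33, x ≠ 0 →
    ((relCert p).map fun e ↦ e.2.2 * (2 * (((e.1 * x).val : ℕ) : ℤ))).sum =
      33 * ((relCert p).map fun e ↦ e.2.2).sum + 66 * relW p x := by
  unfold relCert relW vTab A B Fset Pset; decide

/-! ### §3 The graph decomposition of the count vector of a Hodge multiset -/

/-- **The ten relations**: for a pivot `p`, `c_p(s) = Σ_{a ∈ F} c_a(s) · v_a(p)` for every Hodge
multiset `s` of `ℤ/33`. [folklore] -/
theorem count_pivot_eq {s : Multiset (ZMod 33)} (hs : IsHodgeMultiset s) {p : ZMod 33} (hp : p ∈ Pset) :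
    (Multiset.count p s : ℤ) = ∑ a ∈ Fset, (Multiset.count a s : ℤ) * vTab a p := by
  have h := sum_count_mul_eq_zero_of_cert (relCert p) (relCert_units p hp) (relW p) (relCert_table p hp) hs
  simp only [relW, mul_sub, Finset.sum_sub_distrib, mul_ite, mul_one, mul_zero, Finset.sum_ite_eq',
    Finset.mem_univ, if_true, Finset.sum_ite_mem, Finset.univ_inter] at h
  linarith

/-- **Graph decomposition**: `c_x(s) = Σ_{a ∈ F} c_a(s) · v_a(x)` for EVERY residue `x`. [folklore] -/
theorem count_eq_sum_graph {s : Multiset (ZMod 33)} (hs : IsHodgeMultiset s) (x : ZMod 33) :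
    (Multiset.count x s : ℤ) = ∑ a ∈ Fset, (Multiset.count a s : ℤ) * vTab a x := by
  rcases trichotomy x with rfl | hx | hx
  · rw [Finset.sum_eq_zero fun a ha ↦ by rw [vTab_zero a ha, mul_zero]]
    exact_mod_cast Multiset.count_eq_zero.2 fun h0 ↦ hs.1.1 0 h0 rfl
  · rw [Finset.sum_congr rfl fun a ha ↦ by rw [vTab_F x hx a ha]]
    simp only [mul_ite, mul_one, mul_zero, Finset.sum_ite_eq' Fset x, if_pos hx]
  · exact count_pivot_eq hs hx

/-- **The graph identity as multisets**: `s + Σ_{a∈F} c_a • B a = Σ_{a∈F} c_a • A a`. [folklore] -/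
theorem graph_identity {s : Multiset (ZMod 33)} (hs : IsHodgeMultiset s) :
    s + ∑ a ∈ Fset, Multiset.count a s • B a = ∑ a ∈ Fset, Multiset.count a s • A a := by
  ext x
  have h := count_eq_sum_graph hs x
  simp only [vTab, mul_sub, Finset.sum_sub_distrib] at h
  rw [Multiset.count_add, Multiset.count_sum', Multiset.count_sum']
  simp only [Multiset.count_nsmul]
  have h' : ((Multiset.count x s + ∑ a ∈ Fset, Multiset.count a s * Multiset.count x (B a) : ℕ) : ℤ) =
      ((∑ a ∈ Fset, Multiset.count a s * Multiset.count x (A a) : ℕ) : ℤ) := by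
    push_cast; linarith
  exact_mod_cast h'

/-! ### §4 The level-66 certificates -/

/-- Hodge multisets of level `66` are decidable (a finite check over the units). [folklore] -/
local instance decIsHodgeMultiset66 (s : Multiset (ZMod 66)) : Decidable (IsHodgeMultiset s) := by
  unfold IsHodgeMultiset mNormSum; infer_instance

/-- `CertShape[u]` — a decidable sufficient condition for `u ∈ Supply[66]`: a pair, a Hodge
4-multiset, or one of the two `11`-standard 12-tuples. Local notation only. -/
local notation3 (prettyPrint := false) "CertShape[" u "]" =>
  ((∃ a : ZMod 66, a ≠ 0 ∧ u = ({a, -a} : Multiset (ZMod 66))) ∨ (IsHodgeMultiset u ∧ Multiset.card u = 4) ∨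
    u = ({2, 8, 14, 20, 26, 32, 38, 44, 44, 50, 56, 62} : Multiset (ZMod 66)) ∨
    u = ({1, 7, 13, 19, 25, 31, 37, 43, 49, 55, 55, 61} : Multiset (ZMod 66)))

/-- `σ_{11,2}` of level `66` is a standard supply element (`p = 11`, `d = 6`, `(2,6) = 2`, `6/2 = 3 > 2`).
[cite: Aoki1987, §1 p. 387 (σ_{p,i}, d/(i,d) > 2)] -/
theorem sigma_eleven_two_mem :
    ({2, 8, 14, 20, 26, 32, 38, 44, 44, 50, 56, 62} : Multiset (ZMod 66)) ∈ Supply[66] :=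
  Or.inr ⟨11, 2, by decide, by decide, by decide, by decide, by decide⟩

/-- `σ_{11,1}` of level `66` is a standard supply element (`(1, 6) = 1`, `d = 6 > 2`).
[cite: Aoki1987, Thm. 2-1 (p. 388)] -/
theorem sigma_eleven_one_mem :
    ({1, 7, 13, 19, 25, 31, 37, 43, 49, 55, 55, 61} : Multiset (ZMod 66)) ∈ Supply[66] :=
  Or.inr ⟨11, 1, by decide, by decide, by decide, by decide, by decide⟩

/-- Every certificate shape is a supply element of level `66`. [folklore] -/
theorem mem_supply_of_certShape {u : Multiset (ZMod 66)} (h : CertShape[u]) : u ∈ Supply[66] := by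
  rcases h with h | h | rfl | rfl
  · exact Or.inl (Or.inl (Or.inl h))
  · exact Or.inl (Or.inl (Or.inr h))
  · exact sigma_eleven_two_mem
  · exact sigma_eleven_one_mem

set_option maxRecDepth 100000 in
/-- **The 22 basis certificates** (level `66`): `2•(A a) + Σ(N66 a) = 2•(B a) [+ 2•G for odd a] + Σ(P66 a)`. [folklore] -/
theorem cert66_of_mem_F : ∀ a ∈ Fset,
    LevelRaise[2, 33, A a] + (N66 a).sum =
      LevelRaise[2, 33, B a] + (if oddF a then LevelRaise[2, 33, G] else 0) + (P66 a).sum := by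
  unfold Fset A B N66 P66 oddF G; decide +kernel

set_option maxRecDepth 100000 in
/-- All generators used by the 22 basis certificates have a certificate shape (10 pairs, 21 Hodge
4-multisets of `ℤ/66`, `σ_{11,2}`). [folklore] -/
theorem certShape_of_mem_F : ∀ a ∈ Fset, ∀ u ∈ P66 a + N66 a, CertShape[u] := by
  unfold Fset P66 N66; decide +kernel

/-- `POS` — positive part of the level-66 certificate of da Silva's class (the idea card's
certificate; 75 supply elements: 59 pairs, 16 Hodge 4-multisets). [folklore] -/
def POS : Multiset (Multiset (ZMod 66)) :=
  Multiset.replicate 10 {2, 64} + Multiset.replicate 5 {8, 58} + Multiset.replicate 5 {32, 34} +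
  Multiset.replicate 5 {33, 33} +
  Multiset.replicate 3 {6, 60} + Multiset.replicate 3 {10, 56} + Multiset.replicate 3 {14, 52} +
  Multiset.replicate 3 {20, 46} + Multiset.replicate 3 {24, 42} + Multiset.replicate 3 {28, 38} +
  Multiset.replicate 3 {30, 36} +
  Multiset.replicate 2 {11, 55} + Multiset.replicate 2 {17, 49} + Multiset.replicate 2 {31, 35} +
  {{3, 63}, {5, 61}, {9, 57}, {13, 53}, {19, 47}, {23, 43}, {27, 39}} +
  Multiset.replicate 2 {1, 25, 44, 62} + Multiset.replicate 3 {1, 34, 35, 62} +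
  Multiset.replicate 7 {1, 37, 44, 50} +
  {{7, 29, 45, 51}} + Multiset.replicate 3 {4, 26, 48, 54}

/-- `NEG` — negative part of the level-66 certificate of da Silva's class (40 supply elements: 17
Hodge 4-multisets, 4 pairs, 16 `3`-standard 4-multisets, `σ_{11,2}` twice, `σ_{11,1}` once). [folklore] -/
def NEG : Multiset (Multiset (ZMod 66)) :=
  Multiset.replicate 8 {1, 33, 34, 64} + Multiset.replicate 5 {2, 35, 37, 58} +
  Multiset.replicate 2 {1, 17, 50, 64} + Multiset.replicate 2 {11, 33, 44, 44} +
  Multiset.replicate 3 {4, 62} + {{29, 37}} +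
  Multiset.replicate 3 {6, 28, 48, 50} + Multiset.replicate 3 {10, 32, 36, 54} +
  Multiset.replicate 3 {8, 30, 42, 52} + Multiset.replicate 3 {2, 24, 46, 60} +
  {{9, 31, 39, 53}, {5, 27, 49, 51}, {3, 25, 47, 57}, {1, 23, 45, 63}} +
  Multiset.replicate 2 {2, 8, 14, 20, 26, 32, 38, 44, 44, 50, 56, 62} +
  {{1, 7, 13, 19, 25, 31, 37, 43, 49, 55, 55, 61}}

set_option maxRecDepth 100000 in
/-- **The level-66 identity for da Silva's class, kernel-checked**: `2•G + ΣNEG = ΣPOS` (182 elements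
a side). [folklore] -/
theorem identity_sixtySix : LevelRaise[2, 33, G] + NEG.sum = POS.sum := by
  unfold G; decide +kernel

set_option maxRecDepth 100000 in
/-- All 75 elements of `POS` have a certificate shape. [folklore] -/
theorem certShape_of_mem_POS : ∀ u ∈ POS, CertShape[u] := by
  decide +kernel

set_option maxRecDepth 100000 in
/-- All 40 elements of `NEG` have a certificate shape. [folklore] -/
theorem certShape_of_mem_NEG : ∀ u ∈ NEG, CertShape[u] := by
  decide +kernel

/-! ### §5 Assembly -/

/-- `Multiset.map` of a finite sum of scaled multisets. [folklore] -/
theorem map_sum_nsmul {α β : Type*} (f : α → β) (F : Finset (ZMod 33)) (c : ZMod 33 → ℕ)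
    (X : ZMod 33 → Multiset α) :
    (∑ a ∈ F, c a • X a).map f = ∑ a ∈ F, c a • (X a).map f := by
  induction F using Finset.induction_on with
  | empty => simp
  | insert a F ha ih => rw [Finset.sum_insert ha, Finset.sum_insert ha, Multiset.map_add, Multiset.map_nsmul, ih]

/-- Sum of a scaled family of multisets. [folklore] -/
theorem sum_nsmul' {α : Type*} (n : ℕ) (X : Multiset (Multiset α)) : (n • X).sum = n • X.sum :=
  map_nsmul Multiset.sumAddMonoidHom n X

/-- Sum of a finite sum of scaled families of multisets. [folklore] -/
theorem sum_sum_nsmul {α : Type*} (F : Finset (ZMod 33)) (c : ZMod 33 → ℕ)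
    (X : ZMod 33 → Multiset (Multiset α)) :
    (∑ a ∈ F, c a • X a).sum = ∑ a ∈ F, c a • (X a).sum := by
  induction F using Finset.induction_on with
  | empty => simp
  | insert a F ha ih => rw [Finset.sum_insert ha, Finset.sum_insert ha, Multiset.sum_add, sum_nsmul', ih]

/-- **D33 — every Hodge multiset of `ℤ/33` is stably reachable** (`k = 2`: at level `66`), hence
da Silva's degree `33` has a SATURATED Hodge lattice and, by the line's Transfer
`hodgeConjectureFor_of_saturated`, HC holds for every `Xⁿ₃₃` modulo the named facts of S0 and the
stubs S2↑, S2↓, S3a, S5. [cite: daSilva2021HodgeFermat, §3 (X⁴₃₃, Prop. 3.6)] -/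
theorem stableReach_thirtyThree (s : Multiset (ZMod 33)) (hs : IsHodgeMultiset s) : StableReach[33, s] := by
  refine ⟨2, Nat.two_pos, ?_⟩
  -- weights: `c a` = multiplicity of `a` in `s`; `n` = number of entries of `s` in the odd classes
  obtain ⟨c, hc⟩ : ∃ c : ZMod 33 → ℕ, c = fun a ↦ Multiset.count a s := ⟨_, rfl⟩
  obtain ⟨n, hn⟩ : ∃ n : ℕ, n = ∑ a ∈ Fset, if oddF a then c a else 0 := ⟨_, rfl⟩
  have hgraph : s + ∑ a ∈ Fset, c a • B a = ∑ a ∈ Fset, c a • A a := by rw [hc]; exact graph_identity hs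
  refine ⟨(∑ a ∈ Fset, c a • P66 a) + n • POS, (∑ a ∈ Fset, c a • N66 a) + n • NEG, ?_, ?_, ?_⟩
  · intro u hu
    rcases Multiset.mem_add.1 hu with hu | hu
    · obtain ⟨a, ha, hu⟩ := Multiset.mem_sum.1 hu
      have hu' : u ∈ P66 a := Multiset.mem_of_mem_nsmul hu
      exact mem_supply_of_certShape (certShape_of_mem_F a ha u (Multiset.mem_add.2 (Or.inl hu')))
    · exact mem_supply_of_certShape (certShape_of_mem_POS u (Multiset.mem_of_mem_nsmul hu))
  · intro u hu
    rcases Multiset.mem_add.1 hu with hu | hu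
    · obtain ⟨a, ha, hu⟩ := Multiset.mem_sum.1 hu
      have hu' : u ∈ N66 a := Multiset.mem_of_mem_nsmul hu
      exact mem_supply_of_certShape (certShape_of_mem_F a ha u (Multiset.mem_add.2 (Or.inr hu')))
    · exact mem_supply_of_certShape (certShape_of_mem_NEG u (Multiset.mem_of_mem_nsmul hu))
  · -- the identity
    have hI := congrArg (Multiset.map (fun a : ZMod 33 => ((2 * ZMod.val a : ℕ) : ZMod (2 * 33)))) hgraph
    rw [Multiset.map_add, map_sum_nsmul, map_sum_nsmul] at hI
    -- weighted sum of the basis certificates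
    have hII : ∑ a ∈ Fset, c a • (LevelRaise[2, 33, A a] + (N66 a).sum) =
        ∑ a ∈ Fset, c a • (LevelRaise[2, 33, B a] + (if oddF a then LevelRaise[2, 33, G] else 0) + (P66 a).sum) :=
      Finset.sum_congr rfl fun a ha ↦ by rw [cert66_of_mem_F a ha]
    simp only [nsmul_add, Finset.sum_add_distrib] at hII
    have hodd : ∑ a ∈ Fset, c a • (if oddF a then LevelRaise[2, 33, G] else 0) = n • LevelRaise[2, 33, G] := by
      rw [hn, ← Finset.sum_nsmul_assoc]
      exact Finset.sum_congr rfl fun a _ ↦ by split_ifs <;> simp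
    rw [hodd] at hII
    rw [Multiset.sum_add, Multiset.sum_add, sum_nsmul', sum_nsmul', sum_sum_nsmul, sum_sum_nsmul]
    -- now a linear computation in the additive cancellative monoid of multisets
    have hIII := identity_sixtySix
    -- goal: 2•s + (ΣcN + n•ΣNEG) = ΣcP + n•ΣPOS
    have key : LevelRaise[2, 33, s] + (∑ a ∈ Fset, c a • (N66 a).sum) + n • NEG.sum +
        ∑ a ∈ Fset, c a • LevelRaise[2, 33, B a] =
        (∑ a ∈ Fset, c a • (P66 a).sum) + n • POS.sum + ∑ a ∈ Fset, c a • LevelRaise[2, 33, B a] := by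
      calc LevelRaise[2, 33, s] + (∑ a ∈ Fset, c a • (N66 a).sum) + n • NEG.sum + ∑ a ∈ Fset, c a • LevelRaise[2, 33, B a]
          = (LevelRaise[2, 33, s] + ∑ a ∈ Fset, c a • LevelRaise[2, 33, B a]) + (∑ a ∈ Fset, c a • (N66 a).sum) + n • NEG.sum := by
            abel
        _ = (∑ a ∈ Fset, c a • LevelRaise[2, 33, A a]) + (∑ a ∈ Fset, c a • (N66 a).sum) + n • NEG.sum := by rw [hI]
        _ = (∑ a ∈ Fset, c a • LevelRaise[2, 33, B a]) + n • LevelRaise[2, 33, G] + (∑ a ∈ Fset, c a • (P66 a).sum) + n • NEG.sum := by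
            rw [hII]
        _ = (∑ a ∈ Fset, c a • LevelRaise[2, 33, B a]) + (∑ a ∈ Fset, c a • (P66 a).sum) + n • (LevelRaise[2, 33, G] + NEG.sum) := by
            rw [nsmul_add]; abel
        _ = (∑ a ∈ Fset, c a • (P66 a).sum) + n • POS.sum + ∑ a ∈ Fset, c a • LevelRaise[2, 33, B a] := by
            rw [hIII]; abel
    have key' := add_right_cancel key
    rw [← key']
    abel

end Summit.HodgeConjecture.HodgeConjecture.Theorems.CancelByAnyClaimLattice.D33

end
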